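import Literature.Analysis.FluidPDE.FractionalNSTorus
import Literature.Analysis.FluidPDE.EulerReynolds
import HarnessLib

/-!
# The fractional Navier–Stokes–Reynolds system on `T^d` and Luo–Titi's iteration lemma

Analysis/FluidPDE definitions file. The *fractional Navier–Stokes–Reynolds system* is the
approximate system of the convex-integration scheme of T. Luo and E. S. Titi, *Non-uniqueness of
weak solutions to hyperviscous Navier–Stokes equations: on sharpness of J.-L. Lions exponent*,
Calc. Var. PDE 59 (2020) = arXiv:1808.07595, §2.1, system (2.1):

  `∂ₜ v + ∇·(v ⊗ v) + ∇p + ν(-Δ)^θ v = ∇·R`,  `∇·v = 0`,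

"where `R` is a symmetric `3 × 3` matrix" — the fractional twin of the Navier–Stokes–Reynolds
system of Buckmaster–Vicol (`Torus.IsNSReynoldsOn`, `FluidPDE/NavierStokesReynolds`: viscous term
`-νΔv`) and of the Euler–Reynolds system (`Torus.IsEulerReynoldsOn`, `FluidPDE/EulerReynolds`).
The hyperviscous term is the in-tree spectral fractional Laplacian `Torus.fracLaplacian θ`
(`FluidPDE/FractionalNSTorus`; symbol `(4π²|k|²)^θ` on the unit torus, the sources' `|ξ|^{2θ}` on
the `2π`-periodic torus — equivalent by scaling, see the design notes there).

## Contents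

* `Torus.IsFracNSReynoldsOn S θ ν v p R` (structure): smooth (classical) solutions of (2.1) on
  `T^d × S`, `S ⊆ ℝ` a time set — exactly the fields of `Torus.IsEulerReynoldsOn` /
  `Torus.IsNSReynoldsOn` (joint smoothness of `v`, `p`, `R`; the momentum equation with the
  one-sided time derivative `Torus.timeDerivWithin S`; `div v = 0`; `R` symmetric), with the
  hyperviscous term `ν(-Δ)^θ v` and WITHOUT the trace-free / zero-mean-pressure normalisations
  (Luo–Titi ask only that `R` be symmetric; the trace can always be moved into the pressure).
  Proved sanity lemmas: `Torus.isFracNSReynoldsOn_zero`, `IsFracNSReynoldsOn.mono`.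
* `Torus.LuoTiti2020_iterationLemma` — **Luo–Titi 2020, §2.1, the Iteration Lemma ("Iteration
  Lemma for `L²` weak solutions"; Lemma 1 of the arXiv text), named fact** (`def … : Prop`, not proved
  here): one step of the intermittent convex-integration scheme for (2.1) on the whole time line,
  in the range `θ ∈ [1, 5/4)` of the paper's main theorem (§1, Theorem 1 of the arXiv text); see
  its docstring for the exact
  rendering. Its proof is §3 of the paper (intermittent Beltrami flows after Buckmaster–Vicol,
  Ann. of Math. 189 (2019), §§3–6) and is the research-level core of the sharpness of
  J.-L. Lions' exponent (`Literature/Barriers/NavierStokesRegularity/LionsExponentSharpness`);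
  the half-page deduction "Iteration Lemma ⇒ main theorem (consequence clause)" (§2.1, p. 4 of
  the arXiv text) is formalised in
  `Literature/Barriers/NavierStokesRegularity/LionsExponentSharpnessProofs`.

## Design notes

* Time sets: the lemma is used on `S = univ` (fields smooth on `ℝ × T³` with compact support in
  time); there `Torus.timeDerivWithin univ = Torus.timeDeriv`.
* "`supp_t v`" (the temporal support) is `Function.support v = {t | v t ≠ 0}` of the curried
  field `v : ℝ → (T³ → ℝ³)`, and the printed open `δ`-neighbourhood
  `N_δ(A) = {y : ∃ y' ∈ A, |y - y'| < δ}` is Mathlib's `Metric.thickening δ A` (for which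
  `thickening δ (closure A) = thickening δ A`, so taking the closed support changes nothing).
* Norms: `‖R‖_{L^∞_t L¹_x} ≤ δ` is `∀ t, ∫ ‖R t x‖ dx ≤ δ` with the stress stored by columns
  (`R t x j ∈ ℝ^d`, pointwise norm the maximal column norm, the convention of
  `Torus.IsEulerReynoldsOn`; Luo–Titi do not fix a matrix norm — all are equivalent up to a
  dimensional factor, absorbed by the constant `C` of (2.4) and the free parameter `δ_{q+2}`);
  `‖w‖_{L^∞_t L²_x}` is `sup_t eLpNorm (w t) 2`; `‖w‖_{L^∞_t L¹_x}` is `sup_t ∫ ‖w t x‖ dx`.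

## References

* T. Luo, E. S. Titi, Calc. Var. PDE 59 (2020), Paper 92 = arXiv:1808.07595 (held text; its
  numbering is used: Theorem 1, Remarks 1–2, Lemma 1 = the Iteration Lemma of §2.1 with
  (2.1)–(2.5), proof of Theorem 1 on p. 4, §3 = proof of Lemma 1, Lemma 5 = symmetric
  anti-divergence). [`LuoTiti2020`]
* T. Buckmaster, V. Vicol, Ann. of Math. 189 (2019), §2 (2.1), Prop. 2.1. [`BuckmasterVicol2019`]
-/

noncomputable section

open MeasureTheory Set Filter Topology
open scoped InnerProductSpace ContDiff ENNReal

namespace Literature.Analysis.FluidPDE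

namespace Torus

variable {d : Type*} [Fintype d] [DecidableEq d]

/-! ## Classical solutions of the fractional Navier–Stokes–Reynolds system -/

section FracNSR

/-- Smooth (classical) solutions of the **fractional Navier–Stokes–Reynolds system** with
exponent `θ` and viscosity `ν` on `T^d × S`, `S ⊆ ℝ` a time set (Luo–Titi 2020, §2.1, (2.1):
"`∂ₜv + ∇·(v ⊗ v) + ∇p + ν(-Δ)^θ v = ∇·R`, `∇·v = 0`, where `R` is a symmetric `3 × 3`
matrix"): a velocity `v`, a pressure `p` and a stress `R` (a `2`-tensor field stored by columns,
`R t x j ∈ ℝ^d`), all jointly `C^∞` on `S × T^d`, with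
`∂ₜv + (v·∇)v + ∇p + ν(-Δ)^θ v = div R` pointwise, `div v = 0`, and `R` symmetric. For
divergence-free `v`, `(v·∇)v = ∇·(v ⊗ v)`. The time derivative is the one-sided
`Torus.timeDerivWithin S` and `(-Δ)^θ` is the spectral `Torus.fracLaplacian θ` (applied to the
smooth slice `v t`, where its defining series converges, `FluidPDE/FracLaplacianSmooth`). Exactly
the fields of `Torus.IsNSReynoldsOn` with `-νΔ` replaced by `ν(-Δ)^θ`, minus the trace-free and
zero-mean-pressure normalisations, which Luo–Titi do not impose. [cite: LuoTiti2020, §2.1 (2.1)] -/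
structure IsFracNSReynoldsOn (S : Set ℝ) (θ ν : ℝ) (v : ℝ → UnitAddTorus d → EuclideanSpace ℝ d)
    (p : ℝ → UnitAddTorus d → ℝ) (R : ℝ → UnitAddTorus d → d → EuclideanSpace ℝ d) : Prop where
  /-- The velocity is jointly smooth on `S × T^d`. -/
  smooth_velocity : FunctionSpaces.Torus.IsSmoothSpaceTimeOn S v
  /-- The pressure is jointly smooth on `S × T^d`. -/
  smooth_pressure : FunctionSpaces.Torus.IsSmoothSpaceTimeOn S p
  /-- The stress is jointly smooth on `S × T^d`. -/
  smooth_stress : FunctionSpaces.Torus.IsSmoothSpaceTimeOn S R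
  /-- The momentum equation `∂ₜv + (v·∇)v + ∇p + ν(-Δ)^θ v = div R` holds pointwise on `S × T^d`. -/
  momentum : ∀ t ∈ S, ∀ x,
    FunctionSpaces.Torus.timeDerivWithin S v t x + FunctionSpaces.Torus.convect (v t) (v t) x +
        FunctionSpaces.Torus.gradient (p t) x + ν • fracLaplacian θ (v t) x =
      tensorDivergence (R t) x
  /-- Incompressibility `div v(t) = 0` for `t ∈ S`. -/
  divFree : ∀ t ∈ S, FunctionSpaces.Torus.IsDivFree (v t)
  /-- The stress is symmetric. -/
  symm : ∀ t ∈ S, ∀ x, ∀ i j : d, R t x i j = R t x j i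

variable {S S' : Set ℝ} {θ ν : ℝ} {v : ℝ → UnitAddTorus d → EuclideanSpace ℝ d}
  {p : ℝ → UnitAddTorus d → ℝ} {R : ℝ → UnitAddTorus d → d → EuclideanSpace ℝ d}

/-- The zero triple `(v, p, R) = (0, 0, 0)` solves the fractional Navier–Stokes–Reynolds system
on every time set, for every exponent and viscosity. [folklore] -/
theorem isFracNSReynoldsOn_zero (S : Set ℝ) (θ ν : ℝ) :
    IsFracNSReynoldsOn (d := d) S θ ν (fun _ _ => 0) (fun _ _ => 0) (fun _ _ _ => 0) where
  smooth_velocity := contDiffOn_const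
  smooth_pressure := contDiffOn_const
  smooth_stress := contDiffOn_const
  momentum t _ x := by
    have h0 : fracLaplacian θ (fun _ : UnitAddTorus d => (0 : EuclideanSpace ℝ d)) = 0 :=
      fracLaplacian_zero_fun θ
    simp [h0]
  divFree t _ x := by simp
  symm _ _ _ _ _ := rfl

/-- Restriction to a smaller time set of unique differentiability (e.g. a non-trivial interval,
or any open set): the one-sided time derivatives within `S'` and within `S ⊇ S'` agree on `S'`.
[folklore] -/
theorem IsFracNSReynoldsOn.mono (h : IsFracNSReynoldsOn S θ ν v p R) (hS : S' ⊆ S)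
    (hU : UniqueDiffOn ℝ S') : IsFracNSReynoldsOn S' θ ν v p R where
  smooth_velocity := h.smooth_velocity.mono hS
  smooth_pressure := h.smooth_pressure.mono hS
  smooth_stress := h.smooth_stress.mono hS
  momentum t ht x := by
    have h1 : FunctionSpaces.Torus.timeDerivWithin S' v t x =
        FunctionSpaces.Torus.timeDerivWithin S v t x := by
      have hd : HasDerivWithinAt (fun τ => v τ x) (FunctionSpaces.Torus.timeDerivWithin S v t x) S' t :=
        (h.smooth_velocity.hasDerivWithinAt_slice (hS ht) x).mono hS
      exact hd.derivWithin (hU t ht)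
    rw [h1]
    exact h.momentum t (hS ht) x
  divFree t ht := h.divFree t (hS ht)
  symm t ht := h.symm t (hS ht)

omit [DecidableEq d] in
/-- On the whole time line the one-sided time derivative is the two-sided one. [folklore] -/
theorem timeDerivWithin_univ (u : ℝ → UnitAddTorus d → EuclideanSpace ℝ d) :
    FunctionSpaces.Torus.timeDerivWithin univ u = FunctionSpaces.Torus.timeDeriv u := by
  funext t x
  simp [FunctionSpaces.Torus.timeDeriv, FunctionSpaces.Torus.timeDerivWithin, derivWithin_univ]

/-- On `S = univ` (fields smooth on all of `ℝ × T^d`) the momentum equation holds with the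
two-sided time derivative `Torus.timeDeriv`. [folklore] -/
theorem IsFracNSReynoldsOn.momentum_univ (h : IsFracNSReynoldsOn univ θ ν v p R) (t : ℝ)
    (x : UnitAddTorus d) :
    FunctionSpaces.Torus.timeDeriv v t x + FunctionSpaces.Torus.convect (v t) (v t) x +
        FunctionSpaces.Torus.gradient (p t) x + ν • fracLaplacian θ (v t) x =
      tensorDivergence (R t) x := by
  rw [← timeDerivWithin_univ]
  exact h.momentum t (mem_univ t) x

end FracNSR

/-! ## Luo–Titi 2020, §2.1: the Iteration Lemma (named fact) -/

section IterationLemma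

/-- **Luo–Titi 2020, §2.1 — "Iteration Lemma for `L²` weak solutions" (Lemma 1 of the arXiv
text), named fact.**

*Printed:* "Let `θ ∈ (-∞, 5/4)`. Assume `(v_q, R_q)` is a smooth solution to (2.1) with
(2.1) `‖R_q‖_{L^∞_t L¹_x} ≤ δ_{q+1}`, for some `δ_{q+1} > 0`. Then for any given `δ_{q+2} > 0`,
there exists a smooth solution `(v_{q+1}, R_{q+1})` of (2.1) with
(2.2) `‖R_{q+1}‖_{L^∞_t L¹_x} ≤ δ_{q+2}`, and
(2.3) `supp_t v_{q+1} ∪ supp_t R_{q+1} ⊂ N_{δ_{q+1}}(supp_t v_q ∪ supp_t R_q)`. Here for a given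
set `A ⊂ ℝ`, the `δ`-neighborhood of `A` is denoted by `N_δ(A) = {y ∈ ℝ : ∃ y' ∈ A, |y-y'| < δ}`.
Furthermore, the increment `w_{q+1} = v_{q+1} - v_q` satisfies the estimates
(2.4) `‖w_{q+1}‖_{L^∞_t L²_x} ≤ C δ_{q+1}^{1/2}`, (2.5) `‖w_{q+1}‖_{L^∞_t W^{2θ-1,1}_x} ≤ δ_{q+2}`,
where the positive constant `C` depends only on `θ`."

*Rendering* (every deviation weakens the printed statement or fixes what its proof uses):
(i) exponents `1 ≤ θ < 5/4` — the range of the paper's Theorem 1, where the lemma is applied (for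
`θ < 1` see its Remark 2); viscosity `ν > 0` fixed, and the constant `C` may depend on `θ` AND
`ν` (print: on `θ` only); (ii) "smooth solution to (2.1)" is `Torus.IsFracNSReynoldsOn univ θ ν v p R`
on `ℝ × T³` (some pressure `p`; `R` symmetric), and — as for all flows of the scheme, which
start from a field with compact support in time — `v_q` and `R_q` are assumed to have bounded
temporal support (`Bornology.IsBounded (supp_t v_q ∪ supp_t R_q)`; the proof's constants
`‖v_q‖_{C⁰}`, `‖R_q‖_{C^N}` in §3 are finite exactly then); (iii) `supp_t` is `Function.support`
of the curried field and `N_δ` is `Metric.thickening δ` (design notes of this file); (iv) the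
matrix norm in `‖R‖_{L^∞_t L¹_x}` is the column-sup norm of `Torus.IsEulerReynoldsOn` (all
equivalent; constants absorbed by `C` and the free `δ_{q+2}`); `L^∞_t` is a supremum over all
`t ∈ ℝ` of the (continuous, compactly supported) slice norms; (v) estimate (2.5) is recorded
through its consequence `‖w_{q+1}‖_{L^∞_t L¹_x} ≤ δ_{q+2}` (`‖·‖_{L¹} ≤ ‖·‖_{W^{2θ-1,1}}` for
`2θ - 1 ≥ 1`; the tree has no `W^{s,1}(T³)` scale, and the deduction of Theorem 1's consequence
clause uses only this `L¹` closeness), (2.4) through `eLpNorm (v_{q+1} t - v_q t) 2 ≤ C δ_{q+1}^{1/2}`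
for every `t`. The proof (§3 of the paper: intermittent Beltrami flows `𝕎_(ξ)` with the
Buckmaster–Vicol parameters `σ, r, μ ~ λ_{q+1}^{…}`, the geometric Props. 1–3, `L^p`
decorrelation (Lemma 3 = [MS17]), the perturbation
`w = w^{(p)} + w^{(c)} + w^{(t)}` with the temporal cut-off `ψ` supported in
`N_{δ_{q+1}}(supp_t R_q)`, the symmetric anti-divergence `ℛ` (Lemma 5) with its Calderón–Zygmund
bounds, the commutator estimate (Lemma 6), and the stress estimates of §3.5 in which the
hyperviscous error `‖ℛ(ν(-Δ)^θ w)‖_{L^p} ≲ r^{3/2-3/p} λ^{2θ-1}` is "controllable only for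
`θ < 5/4`") is not formalised. [cite: LuoTiti2020, §2.1 Iteration Lemma (Lemma 1 of arXiv:1808.07595) with (2.1)–(2.5)] -/
def LuoTiti2020_iterationLemma : Prop :=
  ∀ θ ν : ℝ, 1 ≤ θ → θ < 5 / 4 → 0 < ν →
    ∃ C : ℝ, 0 < C ∧
      ∀ (v : ℝ → UnitAddTorus (Fin 3) → EuclideanSpace ℝ (Fin 3))
        (p : ℝ → UnitAddTorus (Fin 3) → ℝ)
        (R : ℝ → UnitAddTorus (Fin 3) → Fin 3 → EuclideanSpace ℝ (Fin 3)) (δ₁ δ₂ : ℝ),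
        IsFracNSReynoldsOn univ θ ν v p R →
        Bornology.IsBounded (Function.support v ∪ Function.support R) →
        0 < δ₁ → 0 < δ₂ → (∀ t, ∫ x, ‖R t x‖ ≤ δ₁) →
        ∃ (v' : ℝ → UnitAddTorus (Fin 3) → EuclideanSpace ℝ (Fin 3))
          (p' : ℝ → UnitAddTorus (Fin 3) → ℝ)
          (R' : ℝ → UnitAddTorus (Fin 3) → Fin 3 → EuclideanSpace ℝ (Fin 3)),
          IsFracNSReynoldsOn univ θ ν v' p' R' ∧
          (∀ t, ∫ x, ‖R' t x‖ ≤ δ₂) ∧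
          Function.support v' ∪ Function.support R' ⊆
            Metric.thickening δ₁ (Function.support v ∪ Function.support R) ∧
          (∀ t, eLpNorm (v' t - v t) 2 volume ≤ ENNReal.ofReal (C * Real.sqrt δ₁)) ∧
          (∀ t, ∫ x, ‖v' t x - v t x‖ ≤ δ₂)

end IterationLemma

end Torus

end Literature.Analysis.FluidPDE
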